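import Summits.FinalStateConjecture.Statement
import Literature.StrongHypotheses.FinalStateConjecture
import HarnessLib
import HarnessLib.Audit.TribunalTags

/-!
# Summit `FinalStateConjecture` — bridges of the Strong-Hypothesis Library (D-0034, skeleton)

Summit-side BRIDGE file for the registry `Literature/StrongHypotheses/FinalStateConjecture.lean`. That registry
is EMPTY after the census recorded in its module docstring (the final state conjecture is the top of the printed
hierarchy: weak cosmic censorship, the Penrose inequality and asymptotic-stationarity statements are consequences
or ingredients; Kerr stability, strong cosmic censorship and matter-model final-state conjectures are
incomparable; rigidity and no-soliton statements are ingredients / theorems; the only strictly stronger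
statements are unnamed sharpenings of the conjecture itself), so there is NO bridge
`@[summit_bridge "FinalStateConjecture.FinalStateConjecture"]` to state, landed or printed, and no summit-side
conjecture `def` under `Summits/FinalStateConjecture/**/Cruxes|Theorems` qualifies for tagging in place
(`TameCensorshipHypothesis`, `RimCriterion` are route-internal and weaker than the summit; `TamePocketExists`,
`ExistsIncurableTameExit` are targets of NEGATIVE lemmas). The root problem decl is `_root_.FinalStateConjecture`
(`Summits/FinalStateConjecture/FinalStateConjecture/Statement.lean`).

This file exists so that the pair (registry, bridges) is uniform across summits and the tribunal reports
`bridge: none / no strong hypothesis registered` for `FinalStateConjecture` from a checked module rather than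
from a missing one. No mathematics is stated or proved here; no `sorry`, no axiom.
-/

namespace Summit.FinalStateConjecture.StrongHypotheses

end Summit.FinalStateConjecture.StrongHypotheses
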